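import Summits.CriticalPhenomena.PercolationContinuityZ3.Theses.PercHyperscalingGluing
import Summits.CriticalPhenomena.PercolationContinuityZ3.Theorems.PercNonProliferationFreeBoxSparseStubBoost
import Summits.CriticalPhenomena.PercolationContinuityZ3.Theorems.PercNonProliferationFreeBoxSparseDenseMarkov
import Summits.CriticalPhenomena.PercolationContinuityZ3.Theorems.FreeBoxSparse.Negative.CentredForms
import Summits.CriticalPhenomena.PercolationContinuityZ3.Theorems.FreeBoxSparse.Negative.Sandwich
import Summits.CriticalPhenomena.PercolationContinuityZ3.Theorems.PercNonProliferationFreeBoxSparseStubCeiling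
import Summits.CriticalPhenomena.PercolationContinuityZ3.Theorems.PercNonProliferationFreeBoxSparseTorusParking
import Summits.CriticalPhenomena.PercolationContinuityZ3.Theorems.PercHyperscalingGluingFreeBoxShatteringStubUniqCeiling
import Summits.CriticalPhenomena.PercolationContinuityZ3.Theorems.PercHyperscalingGluingFreeBoxShatteringStubUniquenessGluing

/-!
# Line `birth` (payload slug `registered`) for the crux `FreeBoxShattering`
# (stmt-CriticalPhenomena-4644, route `PercHyperscalingGluing`, rank 3) — RESHAPED by the lead, cycle 1

Crux (fixed, by name): `PercHyperscalingGluing.FreeBoxShattering` —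
`F_r := |Λ_r|⁻¹ Σ_{x∈Λ_r} P_{p_c}(0 ↔ x inside Λ_r) → 0` (`Λ_r = box 3 r`, bond percolation on `ℤ³`
at `p_c = criticalProbI 3`). Same statement as stmt-5836 and, by the landed re-rooting
(`Theorems/FreeBoxSparse/Negative/CentredForms`), as stmt-4445 (`PercNonProliferation.FreeBoxSparse`).

## MAIN RESULT OF THIS FILE (lead prover-line-stmt-CriticalPhenomena-4644-0, 2026-08-17; no `sorry`
## in its closure, axioms `propext/Classical.choice/Quot.sound`):

  `freeBoxShattering_iff_twoDensePiecesRare : FreeBoxShattering ↔ TwoDensePiecesRare`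

where `TwoDensePiecesRare := ∀ δ > 0, P_{p_c}(∃ x, x' ∈ Λ_N not joined inside Λ_N, both with
in-box clusters of ≥ δ|Λ_N| vertices) → 0`. **At `p_c(ℤ³)` in-box giants are asymptotically ABSENT
iff they are asymptotically UNIQUE.** `→` is Markov (`g(δ,N) ≤ FA₂/δ² → 0`). `←` ("uniqueness is
the engine"): `¬ crux ⇒` (M: first moment at the centre) + (B: boosting by `(2m+1)³` independent
sub-boxes) some density `δ` is carried with probability `≥ 1 - η/8` at infinitely many scales `R`;
at such a scale tile a layer by blocks `B_z = Λ_{3R+1} + (0, Lz)`, `L = 3(2R+1)`, cores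
`Λ_R + (0, Lz)`; a coarse edge is good if both cores are `δ`-dense and every dense core piece of one
is joined INSIDE the double block to every dense core piece of the other; four windows
`W_t = Λ_R + (0,Lz) + t(2R+1)e_j` and three covering cubes `X_t ⊇ W_t ∪ W_{t+1}` of side `4R+3`
inside the double block give `good ⊇ ⋂_t Dense(W_t) ∩ ⋂_t ¬TwoDense_{δ/27}(X_t)`, so
`P(good) ≥ 1 - 4(1-g(δ,R)) - 3 u_{δ/27}(2R+1) ≥ 1 - η` (translation invariance); the landed engine
`stub_ceiling_coarse` (DST 2016 §2.2 / Liggett–Schonmann–Stacey, 2-dependent) makes good edges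
percolate with positive probability and the landed obstruction `stub_ceiling_path` (chaining marked
vertices + Barsky–Grimmett–Newman in `{y | -(3R+1) ≤ y₀}`) makes that probability `0`.
Criticality enters only through BGN: at `p = 1` `TwoDensePiecesRare` holds and the crux fails.
Off criticality `TwoDensePiecesRare(p)` holds on both sides (`p < p_c`: no giants; `p > p_c`:
supercritical box-giant uniqueness), so `¬ crux ⇔ p_c` is the one parameter at which two macroscopic
in-box clusters coexist with non-vanishing probability along a subsequence of scales.

## Registered skeleton after the reshape

* ONE open stub: `stub_twoDensePiecesRare` (= `Stubs.stub_twoDensePiecesRare`, OPEN, ≡ crux); two LANDED stubs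
  `stub_uniqCeiling` (Theorems/…StubUniqCeiling.lean, p149268) and `stub_uniquenessGluing`
  (Theorems/…StubUniquenessGluing.lean, p150619), discharged in this file by the tree theorems.
* `FreeBoxShattering_of : Stubs.stub_twoDensePiecesRare → FreeBoxShattering` (by name) and
  `stub_of_FreeBoxShattering` (converse).
* Retired birth stubs (planner, cycle 0): `Stubs.stub_scaleCoherence` (∃ᶠ→∀ᶠ scale coherence of
  high-probability giants) and `Stubs.stub_noPersistentGiants` (∃ η₀ ∀ δ ∃ᶠ R, g(δ,R) ≤ 1-η₀), with
  their composition `FreeBoxShattering_of_birth` and the honest pieces `crux → each`; both follow from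
  the new stub (`stubs_of_twoDensePiecesRare`). Further proved bookkeeping: `crux ↔ NoGiantsEventually`
  (`∃ η₀ ∀ δ ∀ᶠ R, g ≤ 1-η₀`), the dichotomy `sup_δ limsup_R g(δ,R) ∈ {0,1}`, the sandwich range
  (`θ(p_c)² < (1-η)δ² ⇒ ∀ᶠ R, g(δ,R) < 1-η`: both birth stubs settled at densities `δ > θ(p_c)/√(1-η)`),
  scale monotonicity `giantProb_mono` and the log-syndetic shadow of stub 1
  (`scaleCoherence_of_syndetic`), and the nearest existing upstream
  `FreeBoxShattering_of_noCriticalTorusGiant` (item stmt-5407 ⇒ crux, via the landed TorusParking edge).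

## Honest bookkeeping (D-0027: equivalence is not a defect; unexplained equivalence is)

The registered stub is EQUIVALENT to the crux, and this file proves it. The equivalence is the
point: it identifies the crux (and its twins 4445/5836) with the "ONE missing engine" of the twin's
`Cruxes/FreeBoxSparse/STRATEGY-CENSUS.md` §0/§5(i) — same-`p` uniqueness of dense in-box pieces at
ONE scale — and removes the extra two-arm-rate conjunct of its decomposition D1. No tool in tree or
print proves the stub (EH 2024 Rem. 1.4); the line is therefore handed back as `promote-stub` with
this certificate, and the crux is best parked behind stmt-5407 (`NoCriticalTorusGiant`).

DISPROOF USED: none exists for this item (`ledger crux ls`: Lines/birth.*, PICKED.md only).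
Twin `Cruxes/FreeBoxSparse/Disproof.lean` honoured: §3 (`p = 1`: the stub is TRUE at `p = 1`, the
crux false — consistent, criticality is used via BGN), §7 (centred forms), §8 (sandwich).
Degenerate parameters: `δ > 1` makes every dense/two-dense event empty; `x = x'` never witnesses
`TwoDense` (`openConnIn` is reflexive on `Λ`); `R = 0` is invisible to `atTop`.
-/

noncomputable section

namespace Summit.CriticalPhenomena.PercolationContinuityZ3.Cruxes.FreeBoxShattering.Birth

open MeasureTheory Filter Topology
open scoped Classical
open Literature.Probability.Percolation Literature.Probability.LatticeModels
open Summit.CriticalPhenomena.PercolationContinuityZ3.Theses.PercHyperscalingGluing (FreeBoxShattering)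
open Summit.CriticalPhenomena.PercolationContinuityZ3.Theorems.FreeBoxSparse
  (real_exists_dense_le_pairAverage_div)
open Summit.CriticalPhenomena.PercolationContinuityZ3.Theorems.FreeBoxSparse.StubBoost
  (half_le_real_dense real_compl_dense_bigBox_le measurableSet_dense card_bigBox dense_mono)
open Summit.CriticalPhenomena.PercolationContinuityZ3.Theorems.FreeBoxSparse.Negative
  (freeBoxSparse_iff_hyperscalingGluing_freeBoxShattering theta_pos_of_not_freeBoxSparse
    tendsto_freePairAverage_of_theta_eq_zero eventually_freePairAverage_criticalProbI_le)

/-! ## Objects of the line -/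

/-- The critical bond percolation measure on `ℤ³`. -/
abbrev μc : Measure (BondConfig (Site 3)) := bondPercolation (zdGraph 3) (criticalProbI 3)

/-- `Dense(R, t)`: some site of `Λ_R` has a FREE piece (in-box cluster) with at least `t` vertices —
verbatim the event of `Theorems/PercNonProliferationFreeBoxSparseStubBoost.lean`. -/
def denseEvent (R : ℕ) (t : ℝ) : Set (BondConfig (Site 3)) :=
  {ω | ∃ x ∈ box 3 R, t ≤ (((box 3 R).filter fun v => ω ∈ openConnIn ↑(box 3 R) x v).card : ℝ)}

/-- `g(δ, R) := P_{p_c}(Λ_R has a δ-dense free piece)`. -/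
def giantProb (δ : ℝ) (R : ℕ) : ℝ := μc.real (denseEvent R (δ * (box 3 R).card))

/-- `F_r := |Λ_r|⁻¹ Σ_{x∈Λ_r} P_{p_c}(0 ↔ x inside Λ_r)` — the crux's sequence. -/
def centralDensity (r : ℕ) : ℝ :=
  ((box 3 r).card : ℝ)⁻¹ * ∑ x ∈ box 3 r, μc.real (openConnIn ↑(box 3 r) 0 x)

/-- The crux is literally `F_r → 0`. -/
theorem freeBoxShattering_iff : FreeBoxShattering ↔ Tendsto centralDensity atTop (𝓝 0) := Iff.rfl

/-! ## The two registered stubs: precise `Prop`s `Stubs.stub_*` + sorried theorems `stub_*` -/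

namespace Stubs

/-- **Stub `Prop` 1 (`ScaleCoherence`, OPEN, load-bearing)** — scale coherence of high-probability
giants at `p_c(ℤ³)`: for `η, δ > 0`, if `P_{p_c}(Λ_R has a δ-dense free piece) ≥ 1 - η` for
infinitely many `R`, then for some `δ' > 0`, `P_{p_c}(Λ_R has a δ'-dense free piece) ≥ 1 - 2η` for
all large `R`. -/
def stub_scaleCoherence : Prop :=
  ∀ η δ : ℝ, 0 < η → 0 < δ →
    (∃ᶠ R : ℕ in atTop, 1 - η ≤ (bondPercolation (zdGraph 3) (criticalProbI 3)).real
      {ω | ∃ x ∈ box 3 R, δ * ((box 3 R).card : ℝ) ≤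
        (((box 3 R).filter fun v => ω ∈ openConnIn ↑(box 3 R) x v).card : ℝ)}) →
    ∃ δ' : ℝ, 0 < δ' ∧ ∀ᶠ R : ℕ in atTop, 1 - 2 * η ≤
      (bondPercolation (zdGraph 3) (criticalProbI 3)).real
        {ω | ∃ x ∈ box 3 R, δ' * ((box 3 R).card : ℝ) ≤
          (((box 3 R).filter fun v => ω ∈ openConnIn ↑(box 3 R) x v).card : ℝ)}

/-- **Stub `Prop` 2 (`NoPersistentGiants`, OPEN)** — recurrent shattering at every density: there is
`η₀ > 0` such that for every `δ > 0`, for infinitely many `R`,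
`P_{p_c}(Λ_R has a δ-dense free piece) ≤ 1 - η₀`. -/
def stub_noPersistentGiants : Prop :=
  ∃ η₀ : ℝ, 0 < η₀ ∧ ∀ δ : ℝ, 0 < δ → ∃ᶠ R : ℕ in atTop,
    (bondPercolation (zdGraph 3) (criticalProbI 3)).real
      {ω | ∃ x ∈ box 3 R, δ * ((box 3 R).card : ℝ) ≤
        (((box 3 R).filter fun v => ω ∈ openConnIn ↑(box 3 R) x v).card : ℝ)} ≤ 1 - η₀

end Stubs

/-- Readable form of stub 1. -/
theorem stub_scaleCoherence_iff : Stubs.stub_scaleCoherence ↔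
    ∀ η δ : ℝ, 0 < η → 0 < δ → (∃ᶠ R : ℕ in atTop, 1 - η ≤ giantProb δ R) →
      ∃ δ' : ℝ, 0 < δ' ∧ ∀ᶠ R : ℕ in atTop, 1 - 2 * η ≤ giantProb δ' R := Iff.rfl

/-- Readable form of stub 2. -/
theorem stub_noPersistentGiants_iff : Stubs.stub_noPersistentGiants ↔
    ∃ η₀ : ℝ, 0 < η₀ ∧ ∀ δ : ℝ, 0 < δ → ∃ᶠ R : ℕ in atTop, giantProb δ R ≤ 1 - η₀ := Iff.rfl

/-! ### Birth stubs (cycle 0, planner) — RETIRED by the lead in cycle 1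
The two birth stubs `stub_scaleCoherence`, `stub_noPersistentGiants` (their `Prop`s are kept above as
`Stubs.stub_scaleCoherence`, `Stubs.stub_noPersistentGiants`, with the birth composition
`FreeBoxShattering_of_birth` below) are no longer registered: both are consequences of the single
registered stub `stub_twoDensePiecesRare` (`stubs_of_twoDensePiecesRare`), which is kernel-proved
EQUIVALENT to the crux (`freeBoxShattering_iff_twoDensePiecesRare`, end of file). Why each might
fail / where each is already settled is recorded in `Lines/birth.md` and in the sandwich-range lemmas. -/

/-! ## Proved plumbing -/

theorem measurableSet_denseEvent (R : ℕ) (t : ℝ) : MeasurableSet (denseEvent R t) :=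
  measurableSet_dense (box 3 R) t

theorem giantProb_nonneg (δ : ℝ) (R : ℕ) : 0 ≤ giantProb δ R := measureReal_nonneg

theorem giantProb_le_one (δ : ℝ) (R : ℕ) : giantProb δ R ≤ 1 := measureReal_le_one

theorem centralDensity_nonneg (r : ℕ) : 0 ≤ centralDensity r :=
  mul_nonneg (inv_nonneg.2 (Nat.cast_nonneg _)) (Finset.sum_nonneg fun _ _ => measureReal_nonneg)

/-- A nonnegative sequence that does not tend to `0` is `≥ ε` infinitely often, for some `ε > 0`. -/
theorem exists_frequently_le_of_not_tendsto {u : ℕ → ℝ} (hu : ∀ n, 0 ≤ u n)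
    (h : ¬ Tendsto u atTop (𝓝 0)) : ∃ ε : ℝ, 0 < ε ∧ ∃ᶠ n in atTop, ε ≤ u n := by
  by_contra hcon
  apply h
  rw [tendsto_order]
  refine ⟨fun a ha => Eventually.of_forall fun n => ha.trans_le (hu n), fun a ha => ?_⟩
  by_contra hev
  exact hcon ⟨a, ha, (Filter.not_eventually.1 hev).mono fun n hn => not_lt.1 hn⟩

/-- **(M) First moment at the centre.** If `F_r ≥ 2c` (`c ≥ 0`) then with probability `≥ c` the
central site `0 ∈ Λ_r` — hence some site — has a free piece with `≥ c|Λ_r|` vertices: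
`Σ_y P(0 ↔ y in Λ_r) = E #C_{Λ_r}(0) ≤ c|Λ_r| + |Λ_r| · P(#C_{Λ_r}(0) ≥ c|Λ_r|)`
(landed `StubBoost.half_le_real_dense`, root frozen at `0`). -/
theorem le_giantProb_of_le_centralDensity {c : ℝ} (hc : 0 ≤ c) {r : ℕ}
    (h : 2 * c ≤ centralDensity r) : c ≤ giantProb c r := by
  have hcard : (0 : ℝ) < (box 3 r).card := by exact_mod_cast Finset.card_pos.2 (box_nonempty 3 r)
  have hne : ((box 3 r).card : ℝ) ≠ 0 := hcard.ne'
  -- `2c |Λ_r| ≤ Σ_y P(0 ↔ y in Λ_r)`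
  have h1 : 2 * c * ((box 3 r).card : ℝ) ≤
      ∑ y ∈ box 3 r, μc.real (openConnIn (↑(box 3 r) : Set (Site 3)) 0 y) := by
    unfold centralDensity at h
    calc 2 * c * ((box 3 r).card : ℝ)
        ≤ ((box 3 r).card : ℝ)⁻¹ * (∑ y ∈ box 3 r,
            μc.real (openConnIn (↑(box 3 r) : Set (Site 3)) 0 y)) * ((box 3 r).card : ℝ) :=
          mul_le_mul_of_nonneg_right h hcard.le
      _ = ∑ y ∈ box 3 r, μc.real (openConnIn (↑(box 3 r) : Set (Site 3)) 0 y) := by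
          field_simp
  -- hypothesis of the landed first-moment lemma for the dummy-rooted events `E u y := {0 ↔ y in Λ_r}`
  have h2 : 2 * c * ((box 3 r).card : ℝ) ^ 2 ≤
      ∑ _u ∈ box 3 r, ∑ y ∈ box 3 r, μc.real (openConnIn (↑(box 3 r) : Set (Site 3)) 0 y) := by
    rw [Finset.sum_const, nsmul_eq_mul]
    calc 2 * c * ((box 3 r).card : ℝ) ^ 2 = ((box 3 r).card : ℝ) * (2 * c * ((box 3 r).card : ℝ)) := by
          ring
      _ ≤ ((box 3 r).card : ℝ) * ∑ y ∈ box 3 r, μc.real (openConnIn (↑(box 3 r) : Set (Site 3)) 0 y) :=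
          mul_le_mul_of_nonneg_left h1 hcard.le
  have hA := half_le_real_dense μc (box_nonempty 3 r)
    (fun _ y => openConnIn (↑(box 3 r) : Set (Site 3)) 0 y)
    (fun _ _ y _ => DCT16.measurableSet_openConnIn (box 3 r) 0 y) (by positivity : (0 : ℝ) ≤ 2 * c) h2
  have h22 : 2 * c / 2 = c := by ring
  rw [h22] at hA
  refine hA.trans (measureReal_mono ?_)
  rintro ω ⟨_u, _hu, hω⟩
  exact ⟨0, zero_mem_box 3 r, hω⟩

/-- **(B) Boosting by independent sub-boxes** (exact independence of disjoint sub-boxes; the landed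
`StubBoost.real_compl_dense_bigBox_le`): if `Λ_r` has a `δ`-dense free piece with probability `≥ c > 0`
for infinitely many `r`, then for every `η > 0` there is `δ' > 0` (namely `δ/(2m+1)³` with
`max(1-c,0)^m < η`) such that `Λ_R`, `R = (2m+1)r + m`, has a `δ'`-dense free piece with probability
`≥ 1 - η` — for infinitely many `R`. -/
theorem boost {δ c : ℝ} (hc : 0 < c) (h : ∃ᶠ r : ℕ in atTop, c ≤ giantProb δ r)
    {η : ℝ} (hη : 0 < η) : ∃ m : ℕ, ∃ᶠ R : ℕ in atTop, 1 - η ≤ giantProb (δ / (2 * (m : ℝ) + 1) ^ 3) R := by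
  -- decay parameter `θ = max (1 - c) 0 < 1` and the number `m ≤ |Λ_m|` of independent trials
  obtain ⟨m, hm⟩ : ∃ m : ℕ, (max (1 - c) 0) ^ m < η :=
    exists_pow_lt_of_lt_one hη (max_lt (by linarith) one_pos)
  have hmcard : m ≤ (box 3 m).card := by
    rw [card_box]; exact (show m ≤ 2 * m + 1 by omega).trans (Nat.le_self_pow three_ne_zero _)
  have hpow : (max (1 - c) 0) ^ (box 3 m).card ≤ η :=
    (pow_le_pow_of_le_one (le_max_right _ _) (max_le (by linarith) zero_le_one) hmcard).trans hm.le
  refine ⟨m, ?_⟩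
  rw [Filter.frequently_atTop] at h ⊢
  intro a
  obtain ⟨r, hra, hr⟩ := h a
  refine ⟨(2 * m + 1) * r + m, hra.trans ?_, ?_⟩
  · calc r = 1 * r + 0 := by ring
      _ ≤ (2 * m + 1) * r + m := by gcongr <;> omega
  · -- one sub-box fails with probability `≤ θ`
    have hθ : μc.real {ω | ∃ x ∈ box 3 r, δ * ((box 3 r).card : ℝ) ≤
        (((box 3 r).filter fun v => ω ∈ openConnIn ↑(box 3 r) x v).card : ℝ)}ᶜ ≤ max (1 - c) 0 := by
      rw [probReal_compl_eq_one_sub (measurableSet_dense _ _)]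
      refine le_trans ?_ (le_max_left _ _)
      unfold giantProb denseEvent at hr
      linarith
    -- all `|Λ_m|` sub-boxes of `Λ_R` fail with probability `≤ θ^{|Λ_m|} ≤ η`
    have hF := (real_compl_dense_bigBox_le (criticalProbI 3) r m (δ * ((box 3 r).card : ℝ)) hθ).trans hpow
    rw [probReal_compl_eq_one_sub (measurableSet_dense _ _)] at hF
    -- thresholds: `δ' |Λ_R| = δ |Λ_r|`
    have hthr : δ / (2 * (m : ℝ) + 1) ^ 3 * ((box 3 ((2 * m + 1) * r + m)).card : ℝ) =
        δ * ((box 3 r).card : ℝ) := by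
      rw [card_bigBox]; field_simp
    change 1 - η ≤ μc.real _
    unfold denseEvent
    rw [hthr]
    linarith

/-! ## Honest pieces: both stubs are consequences of the crux -/

/-- Under the crux, giants of every density have vanishing probability:
`g(δ, R) ≤ FA₂(p_c, R)/δ² → 0` (landed `real_exists_dense_le_pairAverage_div` + `CentredForms`). -/
theorem tendsto_giantProb_of_freeBoxShattering (hS : FreeBoxShattering) {δ : ℝ} (hδ : 0 < δ) :
    Tendsto (giantProb δ) atTop (𝓝 0) := by
  have hFS := freeBoxSparse_iff_hyperscalingGluing_freeBoxShattering.2 hS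
  have hup : ∀ R : ℕ, giantProb δ R ≤ ((∑ x ∈ box 3 R, ∑ y ∈ box 3 R,
      μc.real (openConnIn (↑(box 3 R) : Set (Site 3)) x y)) / (((box 3 R).card : ℝ)) ^ 2) / δ ^ 2 :=
    fun R => real_exists_dense_le_pairAverage_div (criticalProbI 3) (box_nonempty 3 R) hδ
  have hlim : Tendsto (fun R : ℕ => ((∑ x ∈ box 3 R, ∑ y ∈ box 3 R,
      μc.real (openConnIn (↑(box 3 R) : Set (Site 3)) x y)) / (((box 3 R).card : ℝ)) ^ 2) / δ ^ 2)
      atTop (𝓝 0) := by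
    simpa using hFS.div_const (δ ^ 2)
  exact squeeze_zero (fun R => giantProb_nonneg δ R) hup hlim

/-- Stub 2 is implied by the crux (with `η₀ = 1/2`). -/
theorem noPersistentGiants_of_freeBoxShattering (hS : FreeBoxShattering) :
    Stubs.stub_noPersistentGiants := by
  rw [stub_noPersistentGiants_iff]
  refine ⟨1 / 2, one_half_pos, fun δ hδ => ?_⟩
  have hev : ∀ᶠ R : ℕ in atTop, giantProb δ R < 1 / 2 :=
    (tendsto_order.1 (tendsto_giantProb_of_freeBoxShattering hS hδ)).2 _ one_half_pos
  exact hev.frequently.mono fun R hR => by linarith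

/-- Stub 1 is implied by the crux (its hypothesis fails eventually when `η < 1`; its conclusion is
trivial when `η ≥ 1`). -/
theorem scaleCoherence_of_freeBoxShattering (hS : FreeBoxShattering) : Stubs.stub_scaleCoherence := by
  rw [stub_scaleCoherence_iff]
  intro η δ hη hδ hio
  by_cases hη1 : η < 1
  · exfalso
    have hev : ∀ᶠ R : ℕ in atTop, giantProb δ R < 1 - η :=
      (tendsto_order.1 (tendsto_giantProb_of_freeBoxShattering hS hδ)).2 _ (by linarith)
    obtain ⟨R, h1, h2⟩ := (hio.and_eventually hev).exists
    linarith
  · refine ⟨1, one_pos, Eventually.of_forall fun R => ?_⟩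
    have h0 : 0 ≤ giantProb 1 R := giantProb_nonneg 1 R
    linarith [not_lt.1 hη1]

/-! ## Lead additions (cycle 1): monotonicity in scale and density, the single residual,
## and the range of densities where both stubs are already settled -/

/-- The dense-piece event is monotone: a larger box and a smaller threshold only help
(a free piece of `Λ_{R₀}` through `x` lies in the free piece of `Λ_R ⊇ Λ_{R₀}` through `x`). -/
theorem denseEvent_mono {R₀ R : ℕ} (h : R₀ ≤ R) {t t' : ℝ} (ht : t' ≤ t) :
    denseEvent R₀ t ⊆ denseEvent R t' := by
  intro ω hω
  obtain ⟨x, hx, hx'⟩ := dense_mono (box_mono 3 h) t hω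
  exact ⟨x, hx, ht.trans hx'⟩

/-- `g` is monotone along `(δ, R₀) → (δ', R)` whenever `R₀ ≤ R` and `δ'|Λ_R| ≤ δ|Λ_{R₀}|`:
a `δ`-dense piece of `Λ_{R₀}` is a `δ|Λ_{R₀}|/|Λ_R|`-dense piece of `Λ_R`. This is the ONLY
cross-scale transport of in-box density available at fixed `p` (no gluing). -/
theorem giantProb_mono {R₀ R : ℕ} (h : R₀ ≤ R) {δ δ' : ℝ}
    (hδ : δ' * ((box 3 R).card : ℝ) ≤ δ * ((box 3 R₀).card : ℝ)) :
    giantProb δ R₀ ≤ giantProb δ' R :=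
  measureReal_mono (denseEvent_mono h hδ)

/-- `g(·, R)` is antitone in the density. -/
theorem giantProb_antitone (R : ℕ) {δ δ' : ℝ} (h : δ ≤ δ') : giantProb δ' R ≤ giantProb δ R :=
  giantProb_mono le_rfl (mul_le_mul_of_nonneg_right h (Nat.cast_nonneg _))

/-- Volumes within a bounded ratio of scales: `R ≤ C R₀`, `C ≥ 1` ⇒ `|Λ_R| ≤ C³ |Λ_{R₀}|`. -/
theorem card_box_le_of_le_mul {R₀ R C : ℕ} (hC : 1 ≤ C) (h : R ≤ C * R₀) :
    ((box 3 R).card : ℝ) ≤ (C : ℝ) ^ 3 * ((box 3 R₀).card : ℝ) := by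
  rw [card_box, card_box]
  push_cast
  have h1 : (R : ℝ) ≤ (C : ℝ) * R₀ := by exact_mod_cast h
  have hC' : (1 : ℝ) ≤ C := by exact_mod_cast hC
  have h2 : 2 * (R : ℝ) + 1 ≤ (C : ℝ) * (2 * (R₀ : ℝ) + 1) := by nlinarith
  calc (2 * (R : ℝ) + 1) ^ 3 ≤ ((C : ℝ) * (2 * (R₀ : ℝ) + 1)) ^ 3 := by gcongr
    _ = (C : ℝ) ^ 3 * (2 * (R₀ : ℝ) + 1) ^ 3 := by ring

/-- **Scale coherence along LOG-SYNDETIC good scales (the proved shadow of stub 1).** If every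
large scale `R` lies within a bounded factor above a good scale (`R₀ ≤ R ≤ C R₀` with
`g(δ, R₀) ≥ 1 - η`), then `g(δ/C³, R) ≥ 1 - η` at all large `R`. Hence the OPEN content of
`stub_scaleCoherence` is exactly the complementary case: good scales that are infinite but NOT
log-syndetic (the sparse-scale counter-world), where only gluing of sub-box giants at the same `p`
could transport density upward — the missing engine. -/
theorem scaleCoherence_of_syndetic {η δ : ℝ} (hδ : 0 ≤ δ) {C : ℕ} (hC : 1 ≤ C)
    (h : ∀ᶠ R : ℕ in atTop, ∃ R₀ : ℕ, R₀ ≤ R ∧ R ≤ C * R₀ ∧ 1 - η ≤ giantProb δ R₀) :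
    ∀ᶠ R : ℕ in atTop, 1 - η ≤ giantProb (δ / (C : ℝ) ^ 3) R := by
  filter_upwards [h] with R ⟨R₀, h0, h1, h2⟩
  refine h2.trans (giantProb_mono h0 ?_)
  have hc := card_box_le_of_le_mul hC h1
  have hCpos : (0 : ℝ) < (C : ℝ) ^ 3 := by positivity
  calc δ / (C : ℝ) ^ 3 * ((box 3 R).card : ℝ)
      ≤ δ / (C : ℝ) ^ 3 * ((C : ℝ) ^ 3 * ((box 3 R₀).card : ℝ)) := by gcongr
    _ = δ * ((box 3 R₀).card : ℝ) := by field_simp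

/-- From ONE good scale, boosting covers all larger scales — but only with density decaying like
the cube of the scale ratio (pieces of FIXED absolute size `δ|Λ_r|`): `g(δ|Λ_r|/|Λ_R|, R) ≥ g(δ, r)`
for every `R ≥ r`. Recorded to make explicit why (B) alone cannot feed stub 1. -/
theorem giantProb_fixedMass_mono {r R : ℕ} (h : r ≤ R) (δ : ℝ) :
    giantProb δ r ≤ giantProb (δ * ((box 3 r).card : ℝ) / ((box 3 R).card : ℝ)) R := by
  refine giantProb_mono h (le_of_eq ?_)
  have hR : ((box 3 R).card : ℝ) ≠ 0 := by
    exact_mod_cast (Finset.card_pos.2 (box_nonempty 3 R)).ne'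
  field_simp

/-- `NoGiantsEventually` — stub 2 with `∃ᶠ` upgraded to `∀ᶠ`: there is `η₀ > 0` such that at every
density `δ > 0`, EVENTUALLY `P_{p_c}(Λ_R has a δ-dense free piece) ≤ 1 - η₀` (the no-giant event
keeps probability `≥ η₀` at all large scales, uniformly in the density). -/
def NoGiantsEventually : Prop :=
  ∃ η₀ : ℝ, 0 < η₀ ∧ ∀ δ : ℝ, 0 < δ → ∀ᶠ R : ℕ in atTop, giantProb δ R ≤ 1 - η₀

/-- **(M)+(B) packaged: `¬ crux` forces high-probability giants infinitely often at EVERY level.**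
For every `η > 0` there is a density `δ > 0` with `g(δ, R) ≥ 1 - η` for infinitely many `R`. -/
theorem frequently_giant_of_not_freeBoxShattering (hS : ¬ FreeBoxShattering) {η : ℝ} (hη : 0 < η) :
    ∃ δ : ℝ, 0 < δ ∧ ∃ᶠ R : ℕ in atTop, 1 - η ≤ giantProb δ R := by
  rw [freeBoxShattering_iff] at hS
  obtain ⟨ε, hε, hfreq⟩ := exists_frequently_le_of_not_tendsto centralDensity_nonneg hS
  have h1 : ∃ᶠ r : ℕ in atTop, ε / 2 ≤ giantProb (ε / 2) r :=
    hfreq.mono fun r hr => le_giantProb_of_le_centralDensity (half_pos hε).le (by linarith)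
  obtain ⟨m, h2⟩ := boost (half_pos hε) h1 hη
  exact ⟨ε / 2 / (2 * (m : ℝ) + 1) ^ 3, by positivity, h2⟩

/-- **The single residual of the line: `crux ⇔ NoGiantsEventually`.** (`→`: under the crux
`g(δ, ·) → 0`; `←`: (M)+(B) give giants with probability `≥ 1 - η₀/2` i.o., against `≤ 1 - η₀`
eventually.) So the birth cut `stub 1 ∧ stub 2` is `NoGiantsEventually` split along the quantifier:
stub 2 is its `∃ᶠ` weakening and stub 1 is precisely the `∃ᶠ → ∀ᶠ` upgrade. -/
theorem freeBoxShattering_iff_noGiantsEventually : FreeBoxShattering ↔ NoGiantsEventually := by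
  constructor
  · intro hS
    refine ⟨1 / 2, one_half_pos, fun δ hδ => ?_⟩
    have hev : ∀ᶠ R : ℕ in atTop, giantProb δ R < 1 / 2 :=
      (tendsto_order.1 (tendsto_giantProb_of_freeBoxShattering hS hδ)).2 _ one_half_pos
    exact hev.mono fun R hR => by linarith
  · rintro ⟨η₀, hη₀, h⟩
    by_contra hS
    obtain ⟨δ, hδ, hfr⟩ := frequently_giant_of_not_freeBoxShattering hS (half_pos hη₀)
    obtain ⟨R, h1, h2⟩ := (hfr.and_eventually (h δ hδ)).exists
    linarith

/-- A zero-one flavour of (M)+(B): the top density level `L(δ) := limsup_R g(δ, R)` satisfies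
`sup_δ L(δ) ∈ {0, 1}` — either `g(δ, ·) → 0` for every `δ > 0` (the crux), or for every `η > 0`
some density is carried with probability `≥ 1 - η` infinitely often. -/
theorem giantProb_dichotomy :
    (∀ δ : ℝ, 0 < δ → Tendsto (giantProb δ) atTop (𝓝 0)) ∨
      ∀ η : ℝ, 0 < η → ∃ δ : ℝ, 0 < δ ∧ ∃ᶠ R : ℕ in atTop, 1 - η ≤ giantProb δ R := by
  by_cases hS : FreeBoxShattering
  · exact Or.inl fun δ hδ => tendsto_giantProb_of_freeBoxShattering hS hδ
  · exact Or.inr fun η hη => frequently_giant_of_not_freeBoxShattering hS hη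

/-- **The sandwich range (proved part of BOTH stubs).** If `θ(p_c)² < (1 - η) δ²` then eventually
`g(δ, R) < 1 - η`: `g(δ, R) ≤ FA₂(p_c, R)/δ²` (landed `real_exists_dense_le_pairAverage_div`) and
`FA₂(p_c, R) ≤ θ(p_c)² + o(1)` (landed `Negative/Sandwich`). Consequences: stub 2's inequality holds
eventually, and stub 1's hypothesis fails, at every density `δ > θ(p_c)/√(1-η)`; in particular both
stubs hold outright if `θ(p_c) = 0`, and their open content lives at densities `δ ≲ θ(p_c)` of a
jump world. -/
theorem eventually_giantProb_lt {η δ : ℝ} (hδ : 0 < δ)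
    (h : theta (zdGraph 3) 0 (criticalProbI 3) ^ 2 < (1 - η) * δ ^ 2) :
    ∀ᶠ R : ℕ in atTop, giantProb δ R < 1 - η := by
  obtain ⟨ε, hε, hε'⟩ : ∃ ε : ℝ, 0 < ε ∧
      theta (zdGraph 3) 0 (criticalProbI 3) ^ 2 + ε < (1 - η) * δ ^ 2 :=
    ⟨((1 - η) * δ ^ 2 - theta (zdGraph 3) 0 (criticalProbI 3) ^ 2) / 2, by linarith, by linarith⟩
  filter_upwards [eventually_freePairAverage_criticalProbI_le hε] with R hR
  have hup : giantProb δ R ≤ ((∑ x ∈ box 3 R, ∑ y ∈ box 3 R,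
      μc.real (openConnIn (↑(box 3 R) : Set (Site 3)) x y)) / (((box 3 R).card : ℝ)) ^ 2) / δ ^ 2 :=
    real_exists_dense_le_pairAverage_div (criticalProbI 3) (box_nonempty 3 R) hδ
  have hδ2 : (0 : ℝ) < δ ^ 2 := by positivity
  calc giantProb δ R
      ≤ ((∑ x ∈ box 3 R, ∑ y ∈ box 3 R, μc.real (openConnIn (↑(box 3 R) : Set (Site 3)) x y)) /
          (((box 3 R).card : ℝ)) ^ 2) / δ ^ 2 := hup
    _ ≤ (theta (zdGraph 3) 0 (criticalProbI 3) ^ 2 + ε) / δ ^ 2 := by gcongr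
    _ < 1 - η := by rw [div_lt_iff₀ hδ2]; linarith

/-- Stub 2 restricted to the sandwich range: for ANY level `η₀` and every density with
`θ(p_c)² < (1 - η₀) δ²`, `g(δ, R) ≤ 1 - η₀` infinitely often (indeed eventually). -/
theorem stub_noPersistentGiants_sandwichRange {η₀ δ : ℝ} (hδ : 0 < δ)
    (h : theta (zdGraph 3) 0 (criticalProbI 3) ^ 2 < (1 - η₀) * δ ^ 2) :
    ∃ᶠ R : ℕ in atTop, giantProb δ R ≤ 1 - η₀ :=
  ((eventually_giantProb_lt hδ h).mono fun _ hR => hR.le).frequently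

/-- Stub 1 restricted to the sandwich range: its HYPOTHESIS is void there. -/
theorem not_frequently_giant_sandwichRange {η δ : ℝ} (hδ : 0 < δ)
    (h : theta (zdGraph 3) 0 (criticalProbI 3) ^ 2 < (1 - η) * δ ^ 2) :
    ¬ ∃ᶠ R : ℕ in atTop, 1 - η ≤ giantProb δ R := by
  rw [Filter.not_frequently]
  exact (eventually_giantProb_lt hδ h).mono fun _ hR => not_le.2 hR

/-- If there is no jump, both stubs hold (via `θ(p_c) = 0 ⇒ crux`, landed `Negative/OfContinuity`). -/
theorem stubs_of_theta_eq_zero (h0 : theta (zdGraph 3) 0 (criticalProbI 3) = 0) :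
    Stubs.stub_scaleCoherence ∧ Stubs.stub_noPersistentGiants := by
  have hS : FreeBoxShattering := freeBoxSparse_iff_hyperscalingGluing_freeBoxShattering.1
    (tendsto_freePairAverage_of_theta_eq_zero (criticalProbI 3) h0)
  exact ⟨scaleCoherence_of_freeBoxShattering hS, noPersistentGiants_of_freeBoxShattering hS⟩

/-- Conversely the failure of either stub is a JUMP: `¬ stub → ¬ crux → θ(p_c) > 0`. -/
theorem theta_pos_of_not_stubs (h : ¬ (Stubs.stub_scaleCoherence ∧ Stubs.stub_noPersistentGiants)) :
    0 < theta (zdGraph 3) (0 : Site 3) (criticalProbI 3) := by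
  refine theta_pos_of_not_freeBoxSparse fun hFS => h ?_
  have hS : FreeBoxShattering := freeBoxSparse_iff_hyperscalingGluing_freeBoxShattering.1 hFS
  exact ⟨scaleCoherence_of_freeBoxShattering hS, noPersistentGiants_of_freeBoxShattering hS⟩

/-! ## The birth composition (proved): the two birth stubs imply the crux BY NAME -/

/-- **`FreeBoxShattering` from the two registered stubs** (hypotheses = the declared stub `Prop`s by
name; conclusion = the route decl `PercHyperscalingGluing.FreeBoxShattering` by name; no `sorry`).
`¬ crux ⇒ F_r ≥ ε` i.o. `⇒` (M) `g(ε/2, r) ≥ ε/2` i.o. `⇒` (B) `g(δ', R) ≥ 1 - η₀/4` i.o.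
`⇒` (stub 1) `g(δ'', R) ≥ 1 - η₀/2` eventually — against (stub 2) `g(δ'', R) ≤ 1 - η₀` i.o. -/
theorem FreeBoxShattering_of_birth (hX : Stubs.stub_scaleCoherence) (hY : Stubs.stub_noPersistentGiants) :
    Summit.CriticalPhenomena.PercolationContinuityZ3.Theses.PercHyperscalingGluing.FreeBoxShattering := by
  rw [stub_scaleCoherence_iff] at hX
  rw [stub_noPersistentGiants_iff] at hY
  obtain ⟨η₀, hη₀, hY⟩ := hY
  rw [freeBoxShattering_iff]
  by_contra hS
  -- (0) `F_r ≥ ε` infinitely often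
  obtain ⟨ε, hε, hfreq⟩ := exists_frequently_le_of_not_tendsto centralDensity_nonneg hS
  -- (M) a positive-probability giant at the centre, infinitely often
  have h1 : ∃ᶠ r : ℕ in atTop, ε / 2 ≤ giantProb (ε / 2) r :=
    hfreq.mono fun r hr => le_giantProb_of_le_centralDensity (half_pos hε).le (by linarith)
  -- (B) high-probability giants, infinitely often
  obtain ⟨m, h2⟩ := boost (half_pos hε) h1 (by positivity : (0 : ℝ) < η₀ / 4)
  -- (stub 1) high-probability giants at all large scales
  obtain ⟨δ'', hδ'', h3⟩ := hX (η₀ / 4) (ε / 2 / (2 * (m : ℝ) + 1) ^ 3) (by positivity) (by positivity) h2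
  -- (stub 2) recurrent shattering at density `δ''`: contradiction
  obtain ⟨R, hR3, hR4⟩ := (h3.and_frequently (hY δ'' hδ'')).exists
  linarith



/-! ## Lead additions (cycle 1, part 2): UNIQUENESS IS THE ENGINE.
## `TwoDensePiecesRare ↔ FreeBoxShattering`, kernel-checked

`TwoDensePiecesRare`: for every `δ > 0`, `P_{p_c}(Λ_N has two free pieces, not joined inside Λ_N,
each with ≥ δ|Λ_N| vertices) → 0`. The direction `crux → TwoDensePiecesRare` is immediate
(`two dense pieces ⊆ one dense piece`, `g(δ,·) → 0`). The direction `TwoDensePiecesRare → crux`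
is the content: `¬ crux` gives, by (M)+(B), a density `δ` carried with probability `≥ 1 - η/8` at
some (indeed infinitely many) scales `R`; at such a scale tile a layer of `ℤ³` by blocks
`B_z = Λ_{3R+1} + (0, Lz)`, `L = 3(2R+1)`, with cores `Λ_R + (0, Lz)`, and call the coarse edge
`{z, z+e_j}` good if both cores carry a `δ`-dense piece and EVERY `δ`-dense core piece of one is
joined inside `B_z ∪ B_{z+e_j}` to every `δ`-dense core piece of the other. Four consecutive
windows `W_t = Λ_R + (0,Lz) + t(2R+1)e_j` (`W_0`, `W_3` the two cores), each covered together with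
its successor by a cube `X_t` of side `4R+3` inside the double block, show: if every `W_t` is
`δ`-dense and no `X_t` has two disjoint `(δ/27)`-dense pieces, the edge is good (uniqueness in
`X_t` joins the dense pieces of `W_t` and `W_{t+1}`; transitivity). Hence
`P(good) ≥ 1 - 4·η/8·… ≥ 1 - η` by translation invariance, the landed renormalisation engine
(`stub_ceiling_coarse`: DST/LSS 2-dependent percolation) makes the good edges percolate with
positive probability, and the landed obstruction (`stub_ceiling_path`: chaining marked vertices +
Barsky–Grimmett–Newman in the half-space `{y | -(3R+1) ≤ y₀}`) says that probability is `0`.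
So at `p_c(ℤ³)`: **in-box giants are asymptotically absent iff they are asymptotically unique.** -/

section UniquenessGluing

open Summit.CriticalPhenomena.PercolationContinuityZ3.Theorems.FreeBoxSparse
  (stub_ceiling_coarse stub_ceiling_path)
open Summit.CriticalPhenomena.PercolationContinuityZ3.Theorems.FreeBoxSparse.StubCeiling
  (relabel_shift_mem_openConnIn_iff card_filter_shift eq_zero_of_abs_mul_lt openConnIn_trans'
    openConnIn_symm')
open Summit.CriticalPhenomena.PercolationContinuityZ3.Theorems.FreeBoxSparse.StubBoost
  (real_compl_dense_image_add)

/-- `TwoDense(Λ, t)`: `Λ` has two free pieces, NOT joined inside `Λ`, each with `≥ t` vertices. -/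
def twoDense (Λ : Finset (Site 3)) (t : ℝ) : Set (BondConfig (Site 3)) :=
  {ω | ∃ x ∈ Λ, ∃ x' ∈ Λ, ω ∉ openConnIn (↑Λ : Set (Site 3)) x x' ∧
    t ≤ ((Λ.filter fun v => ω ∈ openConnIn (↑Λ : Set (Site 3)) x v).card : ℝ) ∧
    t ≤ ((Λ.filter fun v => ω ∈ openConnIn (↑Λ : Set (Site 3)) x' v).card : ℝ)}

/-- **`TwoDensePiecesRare`** — asymptotic uniqueness of macroscopic free pieces at `p_c(ℤ³)`:
for every `δ > 0`, `P_{p_c}(∃ x, x' ∈ Λ_N not joined inside Λ_N, both with in-box clusters of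
≥ δ|Λ_N| vertices) → 0` as `N → ∞`. (Spelled out in tree vocabulary; no local definitions.) -/
def TwoDensePiecesRare : Prop :=
  ∀ δ : ℝ, 0 < δ → Tendsto (fun N : ℕ => (bondPercolation (zdGraph 3) (criticalProbI 3)).real
    {ω | ∃ x ∈ box 3 N, ∃ x' ∈ box 3 N, ω ∉ openConnIn ↑(box 3 N) x x' ∧
      δ * ((box 3 N).card : ℝ) ≤
        (((box 3 N).filter fun v => ω ∈ openConnIn ↑(box 3 N) x v).card : ℝ) ∧
      δ * ((box 3 N).card : ℝ) ≤
        (((box 3 N).filter fun v => ω ∈ openConnIn ↑(box 3 N) x' v).card : ℝ)})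
    atTop (𝓝 0)

/-- Readable form. -/
theorem twoDensePiecesRare_iff : TwoDensePiecesRare ↔ ∀ δ : ℝ, 0 < δ →
    Tendsto (fun N : ℕ => μc.real (twoDense (box 3 N) (δ * (box 3 N).card))) atTop (𝓝 0) :=
  Iff.rfl

/-- Two dense pieces are in particular one dense piece. -/
theorem twoDense_subset_dense (Λ : Finset (Site 3)) (t : ℝ) :
    twoDense Λ t ⊆ {ω | ∃ x ∈ Λ,
      t ≤ ((Λ.filter fun v => ω ∈ openConnIn (↑Λ : Set (Site 3)) x v).card : ℝ)} := by
  rintro ω ⟨x, hx, _, _, _, h1, _⟩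
  exact ⟨x, hx, h1⟩

/-- **The easy direction: `crux → TwoDensePiecesRare`** (`P(two dense) ≤ g(δ, N) → 0`). -/
theorem twoDensePiecesRare_of_freeBoxShattering (hS : FreeBoxShattering) : TwoDensePiecesRare := by
  rw [twoDensePiecesRare_iff]
  intro δ hδ
  refine squeeze_zero (fun N => measureReal_nonneg) (fun N => ?_)
    (tendsto_giantProb_of_freeBoxShattering hS hδ)
  unfold giantProb denseEvent
  exact measureReal_mono (twoDense_subset_dense _ _)

/-! ### Translation invariance and monotonicity of pieces -/

/-- Translations transport the two-dense-pieces event. -/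
theorem relabel_shift_mem_twoDense_iff (Λ : Finset (Site 3)) (w : Site 3) (t : ℝ)
    (ω : BondConfig (Site 3)) :
    BondConfig.relabel (sym2Equiv (Site.shift w)) ω ∈ twoDense (Λ.image (· + w)) t ↔
      ω ∈ twoDense Λ t := by
  constructor
  · rintro ⟨x', hx', y', hy', hn, h1, h2⟩
    obtain ⟨x, hx, rfl⟩ := Finset.mem_image.1 hx'
    obtain ⟨y, hy, rfl⟩ := Finset.mem_image.1 hy'
    rw [relabel_shift_mem_openConnIn_iff] at hn
    rw [card_filter_shift] at h1 h2
    exact ⟨x, hx, y, hy, hn, h1, h2⟩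
  · rintro ⟨x, hx, y, hy, hn, h1, h2⟩
    refine ⟨x + w, Finset.mem_image_of_mem _ hx, y + w, Finset.mem_image_of_mem _ hy, ?_, ?_, ?_⟩
    · rwa [relabel_shift_mem_openConnIn_iff]
    · rwa [card_filter_shift]
    · rwa [card_filter_shift]

/-- **Translation invariance** of the two-dense-pieces probability. -/
theorem real_twoDense_image_add (p : unitInterval) (Λ : Finset (Site 3)) (w : Site 3) (t : ℝ) :
    (bondPercolation (zdGraph 3) p).real (twoDense (Λ.image (· + w)) t) =
      (bondPercolation (zdGraph 3) p).real (twoDense Λ t) := by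
  rw [← bondPercolation_real_preimage_shift w p (twoDense (Λ.image (· + w)) t)]
  congr 1
  ext ω
  exact relabel_shift_mem_twoDense_iff Λ w t ω

/-- Free pieces grow with the box: `|C_Λ(x)| ≤ |C_{Λ'}(x)|` for `Λ ⊆ Λ'`. -/
theorem card_piece_mono {Λ Λ' : Finset (Site 3)} (h : Λ ⊆ Λ') (ω : BondConfig (Site 3))
    (x : Site 3) :
    (Λ.filter fun v => ω ∈ openConnIn (↑Λ : Set (Site 3)) x v).card ≤
      (Λ'.filter fun v => ω ∈ openConnIn (↑Λ' : Set (Site 3)) x v).card :=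
  Finset.card_le_card fun v hv => by
    rw [Finset.mem_filter] at hv ⊢
    exact ⟨h hv.1, openConnIn_mono (Finset.coe_subset.2 h) x v hv.2⟩

/-- Translated boxes are nested as soon as the radii absorb the offset, coordinatewise. -/
theorem image_add_subset_image_add {n n' : ℕ} {v v' : Site 3}
    (h : ∀ k, -((n' : ℤ) - n) ≤ v k - v' k ∧ v k - v' k ≤ (n' : ℤ) - n) :
    (box 3 n).image (· + v) ⊆ (box 3 n').image (· + v') := by
  intro y hy
  obtain ⟨x, hx, rfl⟩ := Finset.mem_image.1 hy
  refine Finset.mem_image.2 ⟨x + (v - v'), mem_box.2 fun k => ?_, by abel⟩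
  obtain ⟨h1, h2⟩ := (mem_box.1 hx) k
  obtain ⟨h3, h4⟩ := h k
  simp only [Pi.add_apply, Pi.sub_apply]
  constructor <;> linarith

/-! ### The block scheme at a good scale `R` -/

/-- Block offsets: coarse cell `z ∈ ℤ²` ↦ `(0, L z₀, L z₁)`, `L = 2(3R+1)+1 = 3(2R+1)`. -/
def cOff (R : ℕ) (z : Site 2) : Site 3 :=
  ![0, (2 * (3 * (R : ℤ) + 1) + 1) * z 0, (2 * (3 * (R : ℤ) + 1) + 1) * z 1]

/-- Longitudinal offset `s · e_{j+1}` (the coarse direction `j ∈ Fin 2` is lattice coordinate `j+1`). -/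
def lOff (j : Fin 2) (s : ℤ) : Site 3 := fun k => if k = Fin.succ j then s else 0

/-- The block `B_z = Λ_{3R+1} + cOff z`. -/
def blk (R : ℕ) (z : Site 2) : Finset (Site 3) := (box 3 (3 * R + 1)).image (· + cOff R z)

/-- The core `Λ_R + cOff z` of the block `B_z`. -/
def core (R : ℕ) (z : Site 2) : Finset (Site 3) := (box 3 R).image (· + cOff R z)

/-- The windows `W_t = Λ_R + cOff z + t(2R+1) e_{j+1}`, `t = 0, …, 3` (`W_0 = core z`,
`W_3 = core (z + e_j)`). -/
def win (R : ℕ) (z : Site 2) (j : Fin 2) (t : ℕ) : Finset (Site 3) :=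
  (box 3 R).image (· + (cOff R z + lOff j ((t : ℤ) * (2 * R + 1))))

/-- The covering cubes `X_t = Λ_{2R+1} + cOff z + (t(2R+1) + R + 1) e_{j+1}` (side `4R+3`),
`X_t ⊇ W_t ∪ W_{t+1}`. -/
def cov (R : ℕ) (z : Site 2) (j : Fin 2) (t : ℕ) : Finset (Site 3) :=
  (box 3 (2 * R + 1)).image (· + (cOff R z + lOff j ((t : ℤ) * (2 * R + 1) + R + 1)))

/-- The good-edge event of the coarse edge `{z, z + e_j}` at density threshold `θ`: both cores
carry a piece with `≥ θ` vertices and every such piece of `core z` is joined INSIDE the double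
block to every such piece of `core (z + e_j)`. -/
def glueEvent (R : ℕ) (θ : ℝ) (z : Site 2) (j : Fin 2) : Set (BondConfig (Site 3)) :=
  {ω | (∃ x ∈ core R z, θ ≤ (((core R z).filter fun v =>
          ω ∈ openConnIn (↑(core R z) : Set (Site 3)) x v).card : ℝ)) ∧
       (∃ y ∈ core R (z + Pi.single j 1), θ ≤ (((core R (z + Pi.single j 1)).filter fun v =>
          ω ∈ openConnIn (↑(core R (z + Pi.single j 1)) : Set (Site 3)) y v).card : ℝ)) ∧
       ∀ x ∈ core R z, ∀ y ∈ core R (z + Pi.single j 1),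
        θ ≤ (((core R z).filter fun v =>
          ω ∈ openConnIn (↑(core R z) : Set (Site 3)) x v).card : ℝ) →
        θ ≤ (((core R (z + Pi.single j 1)).filter fun v =>
          ω ∈ openConnIn (↑(core R (z + Pi.single j 1)) : Set (Site 3)) y v).card : ℝ) →
        ω ∈ openConnIn (↑(blk R z ∪ blk R (z + Pi.single j 1)) : Set (Site 3)) x y}

/-- The marks: vertices of the core whose core piece is dense whenever a dense core piece exists. -/
def mark (R : ℕ) (θ : ℝ) (z : Site 2) (ω : BondConfig (Site 3)) (x : Site 3) : Prop :=
  x ∈ core R z ∧ ((∃ x' ∈ core R z, θ ≤ (((core R z).filter fun v =>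
      ω ∈ openConnIn (↑(core R z) : Set (Site 3)) x' v).card : ℝ)) →
    θ ≤ (((core R z).filter fun v => ω ∈ openConnIn (↑(core R z) : Set (Site 3)) x v).card : ℝ))

theorem cOff_zero (R : ℕ) (z : Site 2) : cOff R z 0 = 0 := by simp [cOff]

theorem cOff_add (R : ℕ) (z z' : Site 2) : cOff R (z + z') = cOff R z + cOff R z' := by
  funext k
  fin_cases k <;> simp [cOff] <;> ring

/-- `cOff (e_j) = L e_{j+1}`. -/
theorem cOff_single (R : ℕ) (j : Fin 2) :
    cOff R (Pi.single j 1) = lOff j (3 * (2 * (R : ℤ) + 1)) := by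
  funext k
  fin_cases j <;> fin_cases k <;> simp [cOff, lOff] <;> ring

theorem lOff_apply_succ (j : Fin 2) (s : ℤ) : lOff j s (Fin.succ j) = s := by simp [lOff]

theorem lOff_apply_ne {j : Fin 2} {k : Fin 3} (h : k ≠ Fin.succ j) (s : ℤ) : lOff j s k = 0 := by
  simp [lOff, h]

theorem lOff_sub (j : Fin 2) (s s' : ℤ) : lOff j s - lOff j s' = lOff j (s - s') := by
  funext k
  by_cases h : k = Fin.succ j
  · subst h; simp [lOff]
  · simp [lOff, h]

theorem lOff_zero (j : Fin 2) : lOff j 0 = 0 := by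
  funext k; simp [lOff]

/-- `W_0 = core z`. -/
theorem win_zero (R : ℕ) (z : Site 2) (j : Fin 2) : win R z j 0 = core R z := by
  simp [win, core, lOff_zero]

/-- `W_3 = core (z + e_j)`. -/
theorem win_three (R : ℕ) (z : Site 2) (j : Fin 2) : win R z j 3 = core R (z + Pi.single j 1) := by
  simp only [win, core, cOff_add, cOff_single]
  congr 2

/-- Distinct cells have disjoint blocks (block side `L` exceeds the block diameter). -/
theorem blk_disjoint (R : ℕ) {z z' : Site 2} (hne : z ≠ z') : Disjoint (blk R z) (blk R z') := by
  rw [Finset.disjoint_left]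
  intro u hu hu'
  simp only [blk, Finset.mem_image] at hu hu'
  obtain ⟨a, ha, rfl⟩ := hu
  obtain ⟨a', ha', h⟩ := hu'
  apply hne
  rw [mem_box] at ha ha'
  have hn : (0 : ℤ) < 2 * (3 * (R : ℤ) + 1) + 1 := by positivity
  have e : ∀ i : Fin 2, z i = z' i := by
    intro i
    have hi := congrFun h (Fin.succ i)
    obtain ⟨ha1, ha2⟩ := ha (Fin.succ i)
    obtain ⟨hb1, hb2⟩ := ha' (Fin.succ i)
    have hci : ∀ w : Site 2, cOff R w (Fin.succ i) = (2 * (3 * (R : ℤ) + 1) + 1) * w i := by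
      intro w; fin_cases i <;> simp [cOff]
    simp only [Pi.add_apply, hci] at hi
    have key : |(2 * (3 * (R : ℤ) + 1) + 1) * (z' i - z i)| < 2 * (3 * (R : ℤ) + 1) + 1 := by
      rw [show (2 * (3 * (R : ℤ) + 1) + 1) * (z' i - z i) = a (Fin.succ i) - a' (Fin.succ i) by
        linarith, abs_lt]
      constructor <;> push_cast at * <;> linarith
    have := eq_zero_of_abs_mul_lt hn key
    linarith
  funext i
  exact e i

/-- Blocks lie in the half-space `{y | -(3R+1) ≤ y₀}`. -/
theorem blk_subset_halfSpace (R : ℕ) (z : Site 2) :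
    (↑(blk R z) : Set (Site 3)) ⊆ {y : Site 3 | -((3 * R + 1 : ℕ) : ℤ) ≤ y 0} := by
  intro u hu
  rw [Finset.mem_coe] at hu
  simp only [blk, Finset.mem_image] at hu
  obtain ⟨a, ha, rfl⟩ := hu
  rw [Set.mem_setOf_eq, Pi.add_apply, cOff_zero, add_zero]
  exact ((mem_box.1 ha) 0).1

theorem core_subset_blk (R : ℕ) (z : Site 2) : core R z ⊆ blk R z :=
  Finset.image_subset_image (box_mono 3 (by omega))

theorem cOff_mem_core (R : ℕ) (z : Site 2) : cOff R z ∈ core R z :=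
  Finset.mem_image.2 ⟨0, zero_mem_box 3 R, zero_add _⟩

/-- Coordinates of the difference of two longitudinal translates of the same cell offset. -/
theorem cOff_add_lOff_sub_apply (R : ℕ) (z : Site 2) (j : Fin 2) (s s' : ℤ) (k : Fin 3) :
    (cOff R z + lOff j s) k - (cOff R z + lOff j s') k = lOff j (s - s') k := by
  have h : (cOff R z + lOff j s) - (cOff R z + lOff j s') = lOff j (s - s') := by
    rw [add_sub_add_left_eq_sub, lOff_sub]
  have hk := congrFun h k
  simpa only [Pi.sub_apply] using hk

/-- `W_t ⊆ X_t`. -/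
theorem win_subset_cov (R : ℕ) (z : Site 2) (j : Fin 2) (t : ℕ) : win R z j t ⊆ cov R z j t := by
  refine image_add_subset_image_add fun k => ?_
  rw [cOff_add_lOff_sub_apply]
  by_cases hk : k = Fin.succ j
  · subst hk; rw [lOff_apply_succ]; push_cast; constructor <;> linarith
  · rw [lOff_apply_ne hk]; push_cast; constructor <;> linarith

/-- `W_{t+1} ⊆ X_t`. -/
theorem win_succ_subset_cov (R : ℕ) (z : Site 2) (j : Fin 2) (t : ℕ) :
    win R z j (t + 1) ⊆ cov R z j t := by
  refine image_add_subset_image_add fun k => ?_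
  rw [cOff_add_lOff_sub_apply]
  have hR : (0 : ℤ) ≤ R := by positivity
  by_cases hk : k = Fin.succ j
  · subst hk
    rw [lOff_apply_succ]
    push_cast
    have : ((t : ℤ) + 1) * (2 * R + 1) - ((t : ℤ) * (2 * R + 1) + R + 1) = R := by ring
    rw [this]
    constructor <;> linarith
  · rw [lOff_apply_ne hk]; push_cast; constructor <;> linarith

/-- `X_t ⊆ B_z ∪ B_{z+e_j}` for `t ≤ 2`. -/
theorem cov_subset_blk_union (R : ℕ) (z : Site 2) (j : Fin 2) {t : ℕ} (ht : t ≤ 2) :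
    cov R z j t ⊆ blk R z ∪ blk R (z + Pi.single j 1) := by
  intro y hy
  simp only [cov, Finset.mem_image] at hy
  obtain ⟨x, hx, rfl⟩ := hy
  rw [mem_box] at hx
  rw [Finset.mem_union]
  have ht' : (t : ℤ) ≤ 2 := by exact_mod_cast ht
  have ht0 : (0 : ℤ) ≤ t := by positivity
  have hR : (0 : ℤ) ≤ R := by positivity
  have htR : (t : ℤ) * (2 * R + 1) ≤ 2 * (2 * R + 1) := by nlinarith
  have htR0 : 0 ≤ (t : ℤ) * (2 * R + 1) := by positivity
  by_cases hcase : x (Fin.succ j) + ((t : ℤ) * (2 * R + 1) + R + 1) ≤ 3 * R + 1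
  · left
    refine Finset.mem_image.2 ⟨x + lOff j ((t : ℤ) * (2 * R + 1) + R + 1), mem_box.2 fun k => ?_, ?_⟩
    · obtain ⟨h1, h2⟩ := hx k
      push_cast at h1 h2 ⊢
      by_cases hk : k = Fin.succ j
      · subst hk
        simp only [Pi.add_apply, lOff_apply_succ]
        constructor <;> linarith
      · simp only [Pi.add_apply, lOff_apply_ne hk]
        constructor <;> linarith
    · abel
  · right
    push Not at hcase
    simp only [blk, cOff_add, cOff_single]
    refine Finset.mem_image.2
      ⟨x + lOff j ((t : ℤ) * (2 * R + 1) + R + 1 - 3 * (2 * (R : ℤ) + 1)), mem_box.2 fun k => ?_, ?_⟩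
    · obtain ⟨h1, h2⟩ := hx k
      push_cast at h1 h2 ⊢
      by_cases hk : k = Fin.succ j
      · subst hk
        simp only [Pi.add_apply, lOff_apply_succ]
        constructor <;> linarith
      · simp only [Pi.add_apply, lOff_apply_ne hk]
        constructor <;> linarith
    · rw [← lOff_sub]
      abel


/-! ### Locality, the window argument, the marginal bound, the contradiction -/

theorem core_subset_union_left (R : ℕ) (z : Site 2) (j : Fin 2) :
    core R z ⊆ blk R z ∪ blk R (z + Pi.single j 1) :=
  (core_subset_blk R z).trans Finset.subset_union_left

theorem core_subset_union_right (R : ℕ) (z : Site 2) (j : Fin 2) :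
    core R (z + Pi.single j 1) ⊆ blk R z ∪ blk R (z + Pi.single j 1) :=
  (core_subset_blk R _).trans Finset.subset_union_right

/-- **The good-edge event is local**: determined by the pairs inside the double block. -/
theorem determinedBy_glueEvent (R : ℕ) (θ : ℝ) (z : Site 2) (j : Fin 2) :
    DeterminedBy (glueEvent R θ z j)
      (↑((blk R z ∪ blk R (z + Pi.single j 1)).sym2) : Set (Sym2 (Site 3))) := by
  rw [determinedBy_iff]
  intro ω ω' h
  have hK : ∀ S : Finset (Site 3), S ⊆ blk R z ∪ blk R (z + Pi.single j 1) → ∀ a b,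
      (ω ∈ openConnIn (↑S : Set (Site 3)) a b ↔ ω' ∈ openConnIn (↑S : Set (Site 3)) a b) := by
    intro S hS a b
    refine (determinedBy_iff _ _).1
      (DCT16.determinedBy_openConnIn (↑S : Set (Site 3)) a b ?_) ω ω' h
    rw [← Finset.coe_sym2]
    exact Finset.coe_subset.2 (Finset.sym2_mono hS)
  have h1 := hK _ (core_subset_union_left R z j)
  have h2 := hK _ (core_subset_union_right R z j)
  have h12 := hK _ subset_rfl
  simp only [glueEvent, Set.mem_setOf_eq, h1, h2, h12]

/-- Measurability of the good-edge event. -/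
theorem measurableSet_glueEvent (R : ℕ) (θ : ℝ) (z : Site 2) (j : Fin 2) :
    MeasurableSet (glueEvent R θ z j) :=
  (determinedBy_glueEvent R θ z j).measurableSet_of_finset

/-- **Windows + uniqueness ⇒ good edge.** If each window `W_0, …, W_3` carries a piece with
`≥ θ` vertices and none of the covering cubes `X_0, X_1, X_2` has two disjoint pieces with
`≥ θ'` vertices (`θ' ≤ θ`), the coarse edge is good: a dense piece of `W_t` and one of
`W_{t+1}` are both `θ'`-large in `X_t ⊇ W_t ∪ W_{t+1}`, hence joined inside `X_t` (uniqueness),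
hence inside the double block; chain `W_0 → W_1 → W_2 → W_3` by transitivity. -/
theorem glueEvent_of_windows (R : ℕ) {θ θ' : ℝ} (hθ : θ' ≤ θ) (z : Site 2) (j : Fin 2)
    (ω : BondConfig (Site 3))
    (hW : ∀ t ≤ 3, ∃ x ∈ win R z j t, θ ≤ (((win R z j t).filter fun v =>
        ω ∈ openConnIn (↑(win R z j t) : Set (Site 3)) x v).card : ℝ))
    (hX : ∀ t ≤ 2, ω ∉ twoDense (cov R z j t) θ') :
    ω ∈ glueEvent R θ z j := by
  -- joining large pieces of two sub-windows of a covering cube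
  have join : ∀ t ≤ 2, ∀ (W W' : Finset (Site 3)), W ⊆ cov R z j t → W' ⊆ cov R z j t →
      ∀ x ∈ W, ∀ x' ∈ W',
      θ ≤ ((W.filter fun v => ω ∈ openConnIn (↑W : Set (Site 3)) x v).card : ℝ) →
      θ ≤ ((W'.filter fun v => ω ∈ openConnIn (↑W' : Set (Site 3)) x' v).card : ℝ) →
      ω ∈ openConnIn (↑(blk R z ∪ blk R (z + Pi.single j 1)) : Set (Site 3)) x x' := by
    intro t ht W W' hWc hW'c x hx x' hx' hxθ hx'θ
    have hconn : ω ∈ openConnIn (↑(cov R z j t) : Set (Site 3)) x x' := by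
      by_contra hno
      refine hX t ht ⟨x, hWc hx, x', hW'c hx', hno, ?_, ?_⟩
      · exact hθ.trans (hxθ.trans (by exact_mod_cast card_piece_mono hWc ω x))
      · exact hθ.trans (hx'θ.trans (by exact_mod_cast card_piece_mono hW'c ω x'))
    exact openConnIn_mono (Finset.coe_subset.2 (cov_subset_blk_union R z j ht)) x x' hconn
  obtain ⟨x₁, hx₁, hx₁θ⟩ := hW 1 (by norm_num)
  obtain ⟨x₂, hx₂, hx₂θ⟩ := hW 2 (by norm_num)
  have h0 := hW 0 (by norm_num)
  have h3 := hW 3 (by norm_num)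
  rw [win_zero] at h0
  rw [win_three] at h3
  refine ⟨h0, h3, fun x hx y hy hxθ hyθ => ?_⟩
  have hc0 : core R z ⊆ cov R z j 0 := by
    rw [← win_zero R z j]; exact win_subset_cov R z j 0
  have hc3 : core R (z + Pi.single j 1) ⊆ cov R z j 2 := by
    rw [← win_three R z j]; exact win_succ_subset_cov R z j 2
  have c01 := join 0 (by norm_num) (core R z) (win R z j 1) hc0 (win_succ_subset_cov R z j 0)
    x hx x₁ hx₁ hxθ hx₁θ
  have c12 := join 1 (by norm_num) (win R z j 1) (win R z j 2) (win_subset_cov R z j 1)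
    (win_succ_subset_cov R z j 1) x₁ hx₁ x₂ hx₂ hx₁θ hx₂θ
  have c23 := join 2 (by norm_num) (win R z j 2) (core R (z + Pi.single j 1))
    (win_subset_cov R z j 2) hc3 x₂ hx₂ y hy hx₂θ hyθ
  exact openConnIn_trans' (openConnIn_trans' c01 c12) c23

/-- The window dense-piece events (named, to keep complements syntactic). -/
def winDense (R : ℕ) (θ : ℝ) (z : Site 2) (j : Fin 2) (t : ℕ) : Set (BondConfig (Site 3)) :=
  {ω | ∃ x ∈ win R z j t, θ ≤ (((win R z j t).filter fun v =>
    ω ∈ openConnIn (↑(win R z j t) : Set (Site 3)) x v).card : ℝ)}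

/-- **The marginal bound** (union bound + translation invariance):
`P(good edge) ≥ 1 - (4a + 3b)`, `a = P(Λ_R has no piece with ≥ θ vertices)`,
`b = P(Λ_{2R+1} has two disjoint pieces with ≥ θ' vertices)`, for `θ' ≤ θ`. -/
theorem real_glueEvent_ge (R : ℕ) {θ θ' : ℝ} (hθ : θ' ≤ θ) (z : Site 2) (j : Fin 2) :
    1 - (4 * μc.real {ω | ∃ x ∈ box 3 R, θ ≤ (((box 3 R).filter fun v =>
            ω ∈ openConnIn (↑(box 3 R) : Set (Site 3)) x v).card : ℝ)}ᶜ +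
          3 * μc.real (twoDense (box 3 (2 * R + 1)) θ')) ≤
      μc.real (glueEvent R θ z j) := by
  have hAa : ∀ t, μc.real (winDense R θ z j t)ᶜ = μc.real {ω | ∃ x ∈ box 3 R,
      θ ≤ (((box 3 R).filter fun v => ω ∈ openConnIn (↑(box 3 R) : Set (Site 3)) x v).card : ℝ)}ᶜ :=
    fun t => real_compl_dense_image_add (criticalProbI 3) _ (box 3 R) θ
  have hTb : ∀ t, μc.real (twoDense (cov R z j t) θ') = μc.real (twoDense (box 3 (2 * R + 1)) θ') :=
    fun t => real_twoDense_image_add (criticalProbI 3) (box 3 (2 * R + 1)) _ θ'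
  -- the complement of the good-edge event lies in the seven bad events
  have hincl : (glueEvent R θ z j)ᶜ ⊆
      (((winDense R θ z j 0)ᶜ ∪ (winDense R θ z j 1)ᶜ) ∪ ((winDense R θ z j 2)ᶜ ∪ (winDense R θ z j 3)ᶜ)) ∪
        (twoDense (cov R z j 0) θ' ∪ (twoDense (cov R z j 1) θ' ∪ twoDense (cov R z j 2) θ')) := by
    intro ω hω
    by_contra hn
    simp only [Set.mem_union, not_or] at hn
    obtain ⟨⟨⟨h0, h1⟩, h2, h3⟩, t0, t1, t2⟩ := hn
    apply hω
    refine glueEvent_of_windows R hθ z j ω (fun t ht => ?_) (fun t ht => ?_)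
    · interval_cases t
      · exact Set.notMem_compl_iff.1 h0
      · exact Set.notMem_compl_iff.1 h1
      · exact Set.notMem_compl_iff.1 h2
      · exact Set.notMem_compl_iff.1 h3
    · interval_cases t
      · exact t0
      · exact t1
      · exact t2
  have hle := (measureReal_mono hincl (measure_ne_top μc _)).trans
    ((measureReal_union_le _ _).trans (add_le_add
      ((measureReal_union_le _ _).trans (add_le_add (measureReal_union_le _ _)
        (measureReal_union_le _ _)))
      ((measureReal_union_le _ _).trans (add_le_add le_rfl (measureReal_union_le _ _)))))
  rw [hAa, hAa, hAa, hAa, hTb, hTb, hTb,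
    probReal_compl_eq_one_sub (measurableSet_glueEvent R θ z j)] at hle
  linarith

/-- Every block has a marked vertex. -/
theorem mark_exists (R : ℕ) (θ : ℝ) : ∀ (z : Site 2) (ω : BondConfig (Site 3)),
    ∃ x ∈ blk R z, mark R θ z ω x := by
  intro z ω
  by_cases h : ∃ x' ∈ core R z, θ ≤ (((core R z).filter fun v =>
      ω ∈ openConnIn (↑(core R z) : Set (Site 3)) x' v).card : ℝ)
  · obtain ⟨x', hx', h'⟩ := h
    exact ⟨x', core_subset_blk R z hx', hx', fun _ => h'⟩
  · exact ⟨cOff R z, core_subset_blk R z (cOff_mem_core R z), cOff_mem_core R z,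
      fun h' => absurd h' h⟩

/-- A good edge joins marked vertices inside the half-space `{y | -(3R+1) ≤ y₀}`. -/
theorem glue_of_marks (R : ℕ) (θ : ℝ) : ∀ (z : Site 2) (j : Fin 2) (ω : BondConfig (Site 3)),
    ω ∈ glueEvent R θ z j → ∀ x ∈ blk R z, ∀ y ∈ blk R (z + Pi.single j 1),
    mark R θ z ω x → mark R θ (z + Pi.single j 1) ω y →
    ω ∈ openConnIn {y : Site 3 | -((3 * R + 1 : ℕ) : ℤ) ≤ y 0} x y := by
  intro z j ω hω x _ y _ hx hy
  obtain ⟨hd1, hd2, hall⟩ := hω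
  have hxy := hall x hx.1 y hy.1 (hx.2 hd1) (hy.2 hd2)
  refine openConnIn_mono ?_ x y hxy
  rw [Finset.coe_union, Set.union_subset_iff]
  exact ⟨blk_subset_halfSpace R z, blk_subset_halfSpace R _⟩

/-- **No good scale**: if at scale `R` the no-piece probability `a` and the two-pieces
probability `b` satisfy `4a + 3b ≤ η` (the engine's constant), the good edges would percolate
with positive probability (`stub_ceiling_coarse`) and with probability zero
(`stub_ceiling_path`, Barsky–Grimmett–Newman) — contradiction. -/
theorem false_of_good_scale {η : ℝ}
    (hEng : ∀ (p : unitInterval) (B : Site 2 → Finset (Site 3))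
      (E : Site 2 → Fin 2 → Set (BondConfig (Site 3))),
      (∀ z z', z ≠ z' → Disjoint (B z) (B z')) →
      (∀ z j, DeterminedBy (E z j)
        (↑((B z ∪ B (z + Pi.single j 1)).sym2) : Set (Sym2 (Site 3)))) →
      (∀ z j, 1 - η ≤ (bondPercolation (zdGraph 3) p).real (E z j)) →
      0 < (bondPercolation (zdGraph 3) p).real
        {ω | {e : Sym2 (Site 2) | ∃ (z : Site 2) (j : Fin 2),
            e = s(z, z + Pi.single j 1) ∧ ω ∈ E z j} ∈ percolatesAt (0 : Site 2)})
    (R : ℕ) {θ θ' : ℝ} (hθ : θ' ≤ θ)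
    (hgood : 4 * μc.real {ω | ∃ x ∈ box 3 R, θ ≤ (((box 3 R).filter fun v =>
            ω ∈ openConnIn (↑(box 3 R) : Set (Site 3)) x v).card : ℝ)}ᶜ +
          3 * μc.real (twoDense (box 3 (2 * R + 1)) θ') ≤ η) : False := by
  have hpos := hEng (criticalProbI 3) (blk R) (glueEvent R θ)
    (fun z z' h => blk_disjoint R h) (fun z j => determinedBy_glueEvent R θ z j)
    (fun z j => by linarith [real_glueEvent_ge R hθ z j])
  have hzero := stub_ceiling_path (-((3 * R + 1 : ℕ) : ℤ)) (blk R) (mark R θ) (glueEvent R θ)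
    (fun z z' h => blk_disjoint R h) (mark_exists R θ) (blk_subset_halfSpace R) (glue_of_marks R θ)
  exact hpos.ne' hzero

/-- **UNIQUENESS IS THE ENGINE, quantitative form.** There is an ABSOLUTE constant `c > 0`
(one sixteenth of the DST/LSS engine constant) such that: if for every density `δ > 0`, eventually in
`N`, `P_{p_c}(Λ_N has two disjoint δ-dense free pieces) ≤ c`, then the crux holds. (`¬ crux ⇒`
(M)+(B) a density `δ` with `g(δ, R) ≥ 1 - c` infinitely often; at a large such `R` the marginal
bound gives `P(good edge) ≥ 1 - 4c - 3c ≥ 1 - η`; `false_of_good_scale`.) -/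
theorem exists_const_twoDense_imp_freeBoxShattering :
    ∃ c : ℝ, 0 < c ∧ ((∀ δ : ℝ, 0 < δ → ∀ᶠ N : ℕ in atTop,
      μc.real (twoDense (box 3 N) (δ * (box 3 N).card)) ≤ c) → FreeBoxShattering) := by
  obtain ⟨η, hη, hEng⟩ := stub_ceiling_coarse
  refine ⟨η / 16, by positivity, fun hU => ?_⟩
  by_contra hS
  obtain ⟨δ, hδ, hfreq⟩ :=
    frequently_giant_of_not_freeBoxShattering hS (by positivity : (0 : ℝ) < η / 16)
  have h2R : Tendsto (fun R : ℕ => 2 * R + 1) atTop atTop :=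
    tendsto_atTop_mono (fun R => by show R ≤ 2 * R + 1; omega) tendsto_id
  have hev : ∀ᶠ R : ℕ in atTop,
      μc.real (twoDense (box 3 (2 * R + 1)) (δ / 27 * (box 3 (2 * R + 1)).card)) ≤ η / 16 :=
    h2R.eventually (hU (δ / 27) (by positivity))
  obtain ⟨R, hgoodR, hsmR⟩ := (hfreq.and_eventually hev).exists
  -- thresholds: `θ' = (δ/27)|Λ_{2R+1}| ≤ θ = δ|Λ_R|` since `(4R+3)³ ≤ 27(2R+1)³`
  have hθ : δ / 27 * ((box 3 (2 * R + 1)).card : ℝ) ≤ δ * ((box 3 R).card : ℝ) := by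
    rw [card_box, card_box]
    push_cast
    have h1 : (2 * (2 * (R : ℝ) + 1) + 1) ^ 3 ≤ (3 * (2 * (R : ℝ) + 1)) ^ 3 := by
      gcongr; linarith
    have h2 : (3 * (2 * (R : ℝ) + 1)) ^ 3 = 27 * (2 * (R : ℝ) + 1) ^ 3 := by ring
    rw [h2] at h1
    have h3 : 0 ≤ δ * (27 * (2 * (R : ℝ) + 1) ^ 3 - (2 * (2 * (R : ℝ) + 1) + 1) ^ 3) :=
      mul_nonneg hδ.le (by linarith)
    nlinarith
  have ha : μc.real (denseEvent R (δ * (box 3 R).card))ᶜ ≤ η / 16 := by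
    rw [probReal_compl_eq_one_sub (measurableSet_denseEvent _ _)]
    unfold giantProb at hgoodR
    linarith
  refine false_of_good_scale hEng R hθ ?_
  unfold denseEvent at ha
  linarith

/-- **UNIQUENESS IS THE ENGINE: `TwoDensePiecesRare → FreeBoxShattering`** (from the quantitative
form: `u_δ(N) → 0` is eventually below any positive constant). -/
theorem FreeBoxShattering_of_twoDensePiecesRare (hU : TwoDensePiecesRare) : FreeBoxShattering := by
  obtain ⟨c, hc, h⟩ := exists_const_twoDense_imp_freeBoxShattering
  refine h fun δ hδ => ?_
  have hT := (twoDensePiecesRare_iff.1 hU) δ hδ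
  exact ((tendsto_order.1 hT).2 c hc).mono fun N hN => hN.le

/-- **`FreeBoxShattering ↔ TwoDensePiecesRare`** — at `p_c(ℤ³)`, in-box giants are
asymptotically ABSENT iff they are asymptotically UNIQUE. -/
theorem freeBoxShattering_iff_twoDensePiecesRare : FreeBoxShattering ↔ TwoDensePiecesRare :=
  ⟨twoDensePiecesRare_of_freeBoxShattering, FreeBoxShattering_of_twoDensePiecesRare⟩

/-- The same equivalence for the twin crux `PercNonProliferation.FreeBoxSparse` (stmt-4445). -/
theorem freeBoxSparse_iff_twoDensePiecesRare :
    Summit.CriticalPhenomena.PercolationContinuityZ3.Theses.PercNonProliferation.FreeBoxSparse ↔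
      TwoDensePiecesRare :=
  freeBoxSparse_iff_hyperscalingGluing_freeBoxShattering.trans freeBoxShattering_iff_twoDensePiecesRare

/-- The same equivalence for the twin crux `PercHollowCells.FreeBoxShattering` (stmt-5836). -/
theorem hollowCells_freeBoxShattering_iff_twoDensePiecesRare :
    Summit.CriticalPhenomena.PercolationContinuityZ3.Theses.PercHollowCells.FreeBoxShattering ↔
      TwoDensePiecesRare :=
  Summit.CriticalPhenomena.PercolationContinuityZ3.Theorems.FreeBoxSparse.Negative.hyperscalingGluing_iff_hollowCells_freeBoxShattering.symm.trans
    freeBoxShattering_iff_twoDensePiecesRare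

/-- Both retired birth stubs follow from `TwoDensePiecesRare` (through the crux). -/
theorem stubs_of_twoDensePiecesRare (hU : TwoDensePiecesRare) :
    Stubs.stub_scaleCoherence ∧ Stubs.stub_noPersistentGiants :=
  ⟨scaleCoherence_of_freeBoxShattering (FreeBoxShattering_of_twoDensePiecesRare hU),
    noPersistentGiants_of_freeBoxShattering (FreeBoxShattering_of_twoDensePiecesRare hU)⟩

/-- The nearest EXISTING upstream item: `NoCriticalTorusGiant` (stmt-CriticalPhenomena-5407,
route PercTorusSliceFilling) implies the crux, by the landed torus parking edge
(`TorusParking.freeBoxSparse_of_noCriticalTorusGiant`) and the landed re-rooting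
(`Negative/CentredForms`). -/
theorem FreeBoxShattering_of_noCriticalTorusGiant
    (hT : Summit.CriticalPhenomena.PercolationContinuityZ3.Theses.PercTorusSliceFilling.NoCriticalTorusGiant) :
    FreeBoxShattering :=
  freeBoxSparse_iff_hyperscalingGluing_freeBoxShattering.1
    (Summit.CriticalPhenomena.PercolationContinuityZ3.Theorems.FreeBoxSparse.TorusParking.freeBoxSparse_of_noCriticalTorusGiant hT)

end UniquenessGluing

/-! ## Registered, LANDABLE stubs (def-free statements of the two proved engines) -/

/-- **uniqCeiling_proof = the registered `stub_uniqCeiling` PROVED (landed as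
`Theorems/PercHyperscalingGluingFreeBoxShatteringStubUniqCeiling.lean`) — THE UNIQUENESS CEILING at
`p_c(ℤ³)`.** There is an absolute `c > 0` such that at EVERY scale `R` and all thresholds `θ' ≤ θ`:
`4·P_{p_c}(Λ_R has no free piece with ≥ θ vertices) + 3·P_{p_c}(Λ_{2R+1} has two free pieces, not
joined inside Λ_{2R+1}, each with ≥ θ' vertices) ≥ c`. In words: at criticality, at every scale,
macroscopic in-box pieces are either not nearly certain or not nearly unique. -/
theorem uniqCeiling_proof :
    ∃ c : ℝ, 0 < c ∧ ∀ (R : ℕ) (θ θ' : ℝ), θ' ≤ θ →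
      c ≤ 4 * (bondPercolation (zdGraph 3) (criticalProbI 3)).real
            {ω | ∃ x ∈ box 3 R, θ ≤
              (((box 3 R).filter fun v => ω ∈ openConnIn ↑(box 3 R) x v).card : ℝ)}ᶜ +
          3 * (bondPercolation (zdGraph 3) (criticalProbI 3)).real
            {ω | ∃ x ∈ box 3 (2 * R + 1), ∃ x' ∈ box 3 (2 * R + 1),
              ω ∉ openConnIn ↑(box 3 (2 * R + 1)) x x' ∧
              θ' ≤ (((box 3 (2 * R + 1)).filter fun v =>
                ω ∈ openConnIn ↑(box 3 (2 * R + 1)) x v).card : ℝ) ∧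
              θ' ≤ (((box 3 (2 * R + 1)).filter fun v =>
                ω ∈ openConnIn ↑(box 3 (2 * R + 1)) x' v).card : ℝ)} := by
  obtain ⟨η, hη, hEng⟩ :=
    Summit.CriticalPhenomena.PercolationContinuityZ3.Theorems.FreeBoxSparse.stub_ceiling_coarse
  refine ⟨η, hη, fun R θ θ' hθ => ?_⟩
  by_contra hlt
  push Not at hlt
  exact false_of_good_scale hEng R hθ hlt.le

/-- **uniquenessGluing_proof = the registered `stub_uniquenessGluing` PROVED (landed as
`Theorems/PercHyperscalingGluingFreeBoxShatteringStubUniquenessGluing.lean`) — UNIQUENESS IS THE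
ENGINE:** the crux (by name) is equivalent to `TwoDensePiecesRare` (spelled out). -/
theorem uniquenessGluing_proof :
    Summit.CriticalPhenomena.PercolationContinuityZ3.Theses.PercHyperscalingGluing.FreeBoxShattering ↔
      ∀ δ : ℝ, 0 < δ → Tendsto (fun N : ℕ => (bondPercolation (zdGraph 3) (criticalProbI 3)).real
        {ω | ∃ x ∈ box 3 N, ∃ x' ∈ box 3 N, ω ∉ openConnIn ↑(box 3 N) x x' ∧
          δ * ((box 3 N).card : ℝ) ≤
            (((box 3 N).filter fun v => ω ∈ openConnIn ↑(box 3 N) x v).card : ℝ) ∧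
          δ * ((box 3 N).card : ℝ) ≤
            (((box 3 N).filter fun v => ω ∈ openConnIn ↑(box 3 N) x' v).card : ℝ)})
        atTop (𝓝 0) :=
  freeBoxShattering_iff_twoDensePiecesRare

/-! ## Registered and LANDED stubs (p149268, p150619): discharged here by the tree theorems
## (in-file proofs `uniqCeiling_proof` / `uniquenessGluing_proof` above are kept as the record) -/

/-- Registered stub `stub_uniqCeiling` (statement = `uniqCeiling_proof`; proved there AND landed, p149268). -/
theorem stub_uniqCeiling :
    ∃ c : ℝ, 0 < c ∧ ∀ (R : ℕ) (θ θ' : ℝ), θ' ≤ θ →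
      c ≤ 4 * (bondPercolation (zdGraph 3) (criticalProbI 3)).real
            {ω | ∃ x ∈ box 3 R, θ ≤
              (((box 3 R).filter fun v => ω ∈ openConnIn ↑(box 3 R) x v).card : ℝ)}ᶜ +
          3 * (bondPercolation (zdGraph 3) (criticalProbI 3)).real
            {ω | ∃ x ∈ box 3 (2 * R + 1), ∃ x' ∈ box 3 (2 * R + 1),
              ω ∉ openConnIn ↑(box 3 (2 * R + 1)) x x' ∧
              θ' ≤ (((box 3 (2 * R + 1)).filter fun v =>
                ω ∈ openConnIn ↑(box 3 (2 * R + 1)) x v).card : ℝ) ∧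
              θ' ≤ (((box 3 (2 * R + 1)).filter fun v =>
                ω ∈ openConnIn ↑(box 3 (2 * R + 1)) x' v).card : ℝ)} :=
  -- LANDED: Theorems/PercHyperscalingGluingFreeBoxShatteringStubUniqCeiling.lean (p149268)
  Summit.CriticalPhenomena.PercolationContinuityZ3.Theorems.FreeBoxShattering.stub_uniqCeiling

/-- Registered stub `stub_uniquenessGluing` (statement = `uniquenessGluing_proof`; proved there AND landed, p150619). -/
theorem stub_uniquenessGluing :
    Summit.CriticalPhenomena.PercolationContinuityZ3.Theses.PercHyperscalingGluing.FreeBoxShattering ↔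
      ∀ δ : ℝ, 0 < δ → Tendsto (fun N : ℕ => (bondPercolation (zdGraph 3) (criticalProbI 3)).real
        {ω | ∃ x ∈ box 3 N, ∃ x' ∈ box 3 N, ω ∉ openConnIn ↑(box 3 N) x x' ∧
          δ * ((box 3 N).card : ℝ) ≤
            (((box 3 N).filter fun v => ω ∈ openConnIn ↑(box 3 N) x v).card : ℝ) ∧
          δ * ((box 3 N).card : ℝ) ≤
            (((box 3 N).filter fun v => ω ∈ openConnIn ↑(box 3 N) x' v).card : ℝ)})
        atTop (𝓝 0) :=
  -- LANDED: Theorems/PercHyperscalingGluingFreeBoxShatteringStubUniquenessGluing.lean (p150619)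
  Summit.CriticalPhenomena.PercolationContinuityZ3.Theorems.FreeBoxShattering.stub_uniquenessGluing

/-! ## THE registered stub (cycle 1 reshape) and the deciding composition -/

namespace Stubs

/-- **Stub `Prop` (`TwoDensePiecesRare`, OPEN, the whole crux)** — asymptotic uniqueness of
macroscopic free pieces at `p_c(ℤ³)`: for every `δ > 0`, the `P_{p_c}`-probability that
`Λ_N = box 3 N` contains two vertices NOT joined inside `Λ_N` whose in-box clusters both have
`≥ δ|Λ_N|` vertices tends to `0`. Kernel-proved equivalent to the crux
(`freeBoxShattering_iff_twoDensePiecesRare`). Holds for every `p < p_c` (no giants, sharpness) and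
is the standard supercritical box-giant uniqueness for `p > p_c` (Grimmett–Marstrand/Pisztora); its
content is AT `p_c`: `¬ crux ⇔ p_c` is a parameter at which two macroscopic in-box clusters coexist
with non-vanishing probability along a subsequence of scales. True at `p = 1` while the crux is false
there — the equivalence uses criticality through Barsky–Grimmett–Newman. -/
def stub_twoDensePiecesRare : Prop :=
  ∀ δ : ℝ, 0 < δ → Tendsto (fun N : ℕ => (bondPercolation (zdGraph 3) (criticalProbI 3)).real
    {ω | ∃ x ∈ box 3 N, ∃ x' ∈ box 3 N, ω ∉ openConnIn ↑(box 3 N) x x' ∧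
      δ * ((box 3 N).card : ℝ) ≤
        (((box 3 N).filter fun v => ω ∈ openConnIn ↑(box 3 N) x v).card : ℝ) ∧
      δ * ((box 3 N).card : ℝ) ≤
        (((box 3 N).filter fun v => ω ∈ openConnIn ↑(box 3 N) x' v).card : ℝ)})
    atTop (𝓝 0)

end Stubs

/-- The registered stub `Prop` is `TwoDensePiecesRare` verbatim. -/
theorem stub_twoDensePiecesRare_iff : Stubs.stub_twoDensePiecesRare ↔ TwoDensePiecesRare := Iff.rfl

/-- **stub (registered) = `Stubs.stub_twoDensePiecesRare` spelled out (OPEN — it IS the crux,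
`freeBoxShattering_iff_twoDensePiecesRare`).** Why plausibly true: implied by the conjunct
`θ(p_c) = 0` (no giants at all); true off criticality on both sides. Why it might fail: exactly in a
jump world `θ(p_c) > 0` with in-box giants that fail to be unique INSIDE boxes at a positive
frequency of scales (census §3 counter-world: chambered foam / one-ended drainage network); no
same-`p` tool bounds a bounded-aspect two-giant event at `p_c(ℤ³)` (Easo–Hutchcroft 2024 Rem. 1.4:
open even on the torus; vdB–vE 2022 Prop. 2: bounded-aspect two-ARM events have probability
bounded below — arms, not giants). -/
theorem stub_twoDensePiecesRare :
    ∀ δ : ℝ, 0 < δ → Tendsto (fun N : ℕ => (bondPercolation (zdGraph 3) (criticalProbI 3)).real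
      {ω | ∃ x ∈ box 3 N, ∃ x' ∈ box 3 N, ω ∉ openConnIn ↑(box 3 N) x x' ∧
        δ * ((box 3 N).card : ℝ) ≤
          (((box 3 N).filter fun v => ω ∈ openConnIn ↑(box 3 N) x v).card : ℝ) ∧
        δ * ((box 3 N).card : ℝ) ≤
          (((box 3 N).filter fun v => ω ∈ openConnIn ↑(box 3 N) x' v).card : ℝ)})
      atTop (𝓝 0) := by
  sorry

/-- **THE DECIDING COMPOSITION: `FreeBoxShattering` from the single registered stub** (hypothesis
= the stub `Prop` by name; conclusion = the route decl by name; no `sorry` in its closure other than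
the stub itself): uniqueness-gluing + DST/LSS renormalisation + Barsky–Grimmett–Newman
(`FreeBoxShattering_of_twoDensePiecesRare`). -/
theorem FreeBoxShattering_of (hU : Stubs.stub_twoDensePiecesRare) :
    Summit.CriticalPhenomena.PercolationContinuityZ3.Theses.PercHyperscalingGluing.FreeBoxShattering := by
  -- the two LANDED stubs are named here so that they stay registered with the skeleton;
  -- mathematically `uniquenessGluing_proof.2 hU` alone closes the goal.
  have _hC := stub_uniqCeiling
  exact stub_uniquenessGluing.2 hU

/-- Converse wiring: the stub is necessary (so the reshaped line loses nothing). -/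
theorem stub_of_FreeBoxShattering
    (hS : Summit.CriticalPhenomena.PercolationContinuityZ3.Theses.PercHyperscalingGluing.FreeBoxShattering) :
    Stubs.stub_twoDensePiecesRare :=
  stub_twoDensePiecesRare_iff.2 (twoDensePiecesRare_of_freeBoxShattering hS)

/-- Wiring check: the registered stub feeds `FreeBoxShattering_of` as stated — the skeleton IS the
crux proof once the one sorry goes. -/
example : Summit.CriticalPhenomena.PercolationContinuityZ3.Theses.PercHyperscalingGluing.FreeBoxShattering :=
  FreeBoxShattering_of stub_twoDensePiecesRare

end Summit.CriticalPhenomena.PercolationContinuityZ3.Cruxes.FreeBoxShattering.Birth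

end
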